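import Summits.BirchSwinnertonDyer.BirchSwinnertonDyer.Theorems.RamifiedHeegnerPairWAllExclAddGssAtThreeColumnAssembly
import Summits.BirchSwinnertonDyer.BirchSwinnertonDyer.Theorems.RamifiedHeegnerPairGss2LowerAtThreeRankZeroCertificateRoadByName
import Summits.BirchSwinnertonDyer.BirchSwinnertonDyer.Theorems.RamifiedHeegnerPairLeafRankOneUpperAtThreeTwistUnit
import Summits.BirchSwinnertonDyer.BirchSwinnertonDyer.Theorems.RamifiedHeegnerPairLeafRankZeroUpperAtThreeTwistUnit
import HarnessLib

/-!
# Route `RamifiedHeegnerPair` (leaf `WAllExclAddGssAtThree`, W-ALL row 2·3@3) — the COLUMN ASSEMBLY v3: BOTH separation inputs paid by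
# TWIST-UNIT statements (TU₀ on the rank-zero leaf: rhp-p2 g7 p631701; TU₁ on the rank-one leaf: p630223). The Gss2 leaf closes from
# PRINT ∧ the pair statements on all frames (T1⁻: A 27200, A₃ₙₙ, A₀; T1⁺ readings: S2 27492, Σ★″ 27493) ∧ TU₀ ∧ TU₁ —
# NO member half, NO U₀|3Nn, NO Kato-⊇ appears as a hypothesis: everything is in Kolyvagin's currency plus two twist-unit ∃-statements

HONEST FRAMING. Theorems only; helper file (`--supports stmt-BirchSwinnertonDyer-26021 --as helper`); nothing is booked, no item is closed,
BSD is not proved for any curve. EVERY research hypothesis is OPEN: A / A₃ₙₙ / A₀ (T1⁻ at an additive 3: no engine in print), S2 / Σ★″ (T1⁺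
readings of Jetchev 2008 at p ∣ N), TU₀ / TU₁ (arithmetic-statistics ∃-statements with SURPLUS over the leaf — «some Heegner field whose
complementary-rank twist has 3-unit #Ш_an» — no print at an additive 3: Ono–Skinner 1998, Prasanna 2010, Burungale–Hida–Tian exclude p ∣ N);
the print conjunctions PUB 27199 / PUB⁺ 27491 / PUB₀⁺ and the Matar–Nekovář fact are un-discharged named facts. Lead prover bsd-line-rhp-p1
g6, 2026-08-28. Sequel of v1 (p631681: S₋ := L₀ 26023) and v2 (`…ColumnAssemblyTwistUnit`: S₋ := TU₁, L₀ derived).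

CHAIN. TU₀ ⟹ U₀ 26024 (rhp-p2 `RamifiedPairUpperBound.leafRankZeroUpperAtThree_of_pubManin_of_divisibilityReading_of_sigmaStar_of_twistUnitZero`,
with PUB₀⁺, S2, Σ★″) ⟹ U₀|3Nn (`nonSurjThreeRows_of_leafRankZeroUpperAtThree`) ⟹ L₁ 26021 (v5 composition with PUB, A, STRUCT, A₃ₙₙ);
TU₁ ⟹ U₁ 26022 (p630223, with PUB⁺, S2, Σ★″) ⟹ L₀ 26023 (p631233 §3, with PUB, STRUCT, A₀); `closes` (GZK). The proof graph is acyclic.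

* `wAllExclAddGssAtThree_of_print_of_pairStatements_of_twistUnits` — the statement above.

References: [cite: MatarNekovar2019, Thm. 0.7 (p. 456) and §0.11 (p. 457)] [cite: McCallumLMS1991, §5 Cor. 5.6 (p. 310)]
[cite: Jetchev2008, Thm. 1.4, Conj. 1.3] [cite: OnoSkinner1998, Thm. 1] [cite: Kato2004Asterisque, Thm. 14.5 (3) (p. 236)]
[cite: Miller2011LMS, Def. 1.1] [cite: GrossZagier1986, Thm. I.(6.3)] [cite: Kolyvagin1990, Thm. A] [cite: Mazur1978, Cor. 4.1].
-/

-- D-0017: single-problem summit, so `Summit.BirchSwinnertonDyer.BirchSwinnertonDyer.…` repeats a namespace BY DESIGN.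
set_option linter.dupNamespace false
set_option autoImplicit false

noncomputable section

open scoped Classical NumberField

open WeierstrassCurve Literature.NumberTheory.EllipticCurves
  Literature.NumberTheory.EllipticCurves.Rank1Residual
  Literature.NumberTheory.EllipticCurves.Rank1Residual.Typed
  Summit.BirchSwinnertonDyer.Rank1Residual
  Summit.BirchSwinnertonDyer.Rank1Residual.Additive
  Summit.BirchSwinnertonDyer.BirchSwinnertonDyer.Theorems
  Summit.BirchSwinnertonDyer.BirchSwinnertonDyer.Theses.RamifiedHeegnerPair

namespace Summit.BirchSwinnertonDyer.BirchSwinnertonDyer.Theorems.RamifiedPairLowerBound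

/-- **THE Gss2 COLUMN MODULO THE PAIR STATEMENTS, v3 (S₊ := TU₀, S₋ := TU₁; U₀ and L₀ DERIVED).** `WAllExclAddGssAtThree` from: PRINT —
GZK, PUB 27199, PUB⁺ 27491, PUB₀⁺ (rhp-p2's rank-zero print conjunction, verbatim), the Matar–Nekovář structure fact; T1⁻ — A 27200, A₃ₙₙ,
A₀; the T1⁺ readings — S2 27492, Σ★″ 27493; and the two TWIST-UNIT statements TU₀ (rank-zero leaf) and TU₁ (rank-one leaf). No member half
of the route and no row-restricted upper half is a hypothesis. Books nothing; states what the column costs when both separations are paid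
by twist-unit ∃-statements. [cite: Miller2011LMS, Def. 1.1] [cite: MatarNekovar2019, Thm. 0.7 (p. 456) and §0.11 (p. 457)]
[cite: Jetchev2008, Thm. 1.4] [cite: OnoSkinner1998, Thm. 1] -/
theorem wAllExclAddGssAtThree_of_print_of_pairStatements_of_twistUnits
    (hP : PublishedInputGZK) (hpub : Gss2LowerPrintedInputsAtThree) (hpubU : LeafRankOnePrintedInputsAtThree)
    (hpub0 : (∀ (N : ℕ) [NeZero N] (W : WeierstrassCurve ℚ) (K : Type) [Field K] [NumberField K],
        Literature.NumberTheory.EllipticCurves.gross_zagier N W K) ∧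
      (∀ (N : ℕ) [NeZero N] (W : WeierstrassCurve ℚ) (K : Type) [Field K] [NumberField K],
        Literature.NumberTheory.EllipticCurves.kolyvagin N W K) ∧
      Literature.NumberTheory.EllipticCurves.rank_eq_analyticRank_of_analyticRank_le_one ∧
      WeierstrassCurve.hasEntireLFunction_rat ∧
      Literature.NumberTheory.EllipticCurves.MatarNekovar2019.thm07_padicValNat_card_sha_primary_add_le_of_globalDivisibility_of_irreducible ∧
      Literature.NumberTheory.EllipticCurves.ModularForms.exists_isNewformOf ∧
      Literature.NumberTheory.EllipticCurves.bumpFriedbergHoffstein_exists_heegnerField_split_twist_simpleZero ∧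
      Literature.NumberTheory.EllipticCurves.ModularForms.nonempty_modularParametrizationData ∧
      WeierstrassCurve.bsdRHS_eq_of_isIsogenous ∧
      Literature.NumberTheory.EllipticCurves.ModularForms.mazur_not_dvd_maninConstant_of_odd ∧
      Literature.NumberTheory.EllipticCurves.ModularForms.abbesUllmo_not_dvd_maninConstant_of_not_dvd_level ∧
      Literature.NumberTheory.EllipticCurves.ModularForms.cesnavicius_not_two_dvd_maninConstant_of_two_dvd_level)
    (hMN : MatarNekovar2019.thm07_pow_dvd_card_sha_primary_of_certificate_of_irreducible)
    (hC : Gss2RankOneMcCallumCertificateAtThreeTower)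
    (hC3 : ∀ (W : WeierstrassCurve ℚ) [W.IsElliptic] [W.IsGloballyMinimal], ¬ W.HasCM →
      Literature.NumberTheory.EllipticCurves.Rank1Residual.Addv W 3 → Summit.BirchSwinnertonDyer.Rank1Residual.Additive.SubGss W 3 →
      W.analyticRank = 1 → ¬ W.HasSurjectiveModNGaloisRep 3 →
      ∃ (N : ℕ) (_ : NeZero N) (K : Type) (_ : Field K) (_ : NumberField K)
        (Dt : Literature.NumberTheory.EllipticCurves.ModularForms.ModularParametrizationData W N)
        (H : Literature.NumberTheory.EllipticCurves.HeegnerDatum N (NumberField.discr K)) (ι : K →+* ℂ)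
        (P : (W.baseChange K).toAffine.Point) (Wd : WeierstrassCurve ℚ) (_ : Wd.IsElliptic) (_ : Wd.IsGloballyMinimal)
        (Cd : WeierstrassCurve.VariableChange ℚ) (M : ℕ),
        W.conductorNorm ℤ = N ∧ Literature.NumberTheory.EllipticCurves.IsImaginaryQuadratic K ∧ Odd (NumberField.discr K) ∧
        Literature.NumberTheory.EllipticCurves.SatisfiesHeegnerHypothesis N K ∧
        (W.quadraticTwist (NumberField.discr K : ℚ)).entireLFunction 1 ≠ 0 ∧
        WeierstrassCurve.Affine.Point.map ι.toRatAlgHom P = Literature.NumberTheory.EllipticCurves.ModularForms.heegnerPointComplex Dt H ∧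
        Cd • W.quadraticTwist (NumberField.discr K : ℚ) = Wd ∧
        (2 * M : ℤ) ≤ padicValNat 3 W.tamagawaProduct + padicValNat 3 Wd.tamagawaProduct + 2 * padicValRat 3 (Dt.c : ℚ) ∧
        Summit.BirchSwinnertonDyer.Rank1Residual.X11b.Three.Koly.CertificateAt Dt H.β ι 3 M)
    (hC0 : ∀ (W : WeierstrassCurve ℚ) [W.IsElliptic] [W.IsGloballyMinimal], ¬ W.HasCM →
      Literature.NumberTheory.EllipticCurves.Rank1Residual.Addv W 3 →
      Summit.BirchSwinnertonDyer.Rank1Residual.Additive.SubGss W 3 → W.analyticRank = 0 →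
      ∃ (N : ℕ) (_ : NeZero N) (K : Type) (_ : Field K) (_ : NumberField K)
        (Dt : Literature.NumberTheory.EllipticCurves.ModularForms.ModularParametrizationData W N)
        (H : Literature.NumberTheory.EllipticCurves.HeegnerDatum N (NumberField.discr K)) (ι : K →+* ℂ)
        (P : (W.baseChange K).toAffine.Point) (Wd : WeierstrassCurve ℚ) (_ : Wd.IsElliptic) (_ : Wd.IsGloballyMinimal)
        (Cd : WeierstrassCurve.VariableChange ℚ) (M : ℕ),
        W.conductorNorm ℤ = N ∧ Literature.NumberTheory.EllipticCurves.IsImaginaryQuadratic K ∧ Odd (NumberField.discr K) ∧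
        Literature.NumberTheory.EllipticCurves.SatisfiesHeegnerHypothesis N K ∧
        (W.quadraticTwist (NumberField.discr K : ℚ)).analyticRank = 1 ∧
        WeierstrassCurve.Affine.Point.map ι.toRatAlgHom P =
          Literature.NumberTheory.EllipticCurves.ModularForms.heegnerPointComplex Dt H ∧
        Cd • W.quadraticTwist (NumberField.discr K : ℚ) = Wd ∧
        (2 * M : ℤ) ≤ padicValNat 3 W.tamagawaProduct + padicValNat 3 Wd.tamagawaProduct + 2 * padicValRat 3 (Dt.c : ℚ) ∧
        Summit.BirchSwinnertonDyer.Rank1Residual.X11b.Three.Koly.CertificateAt Dt H.β ι 3 M)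
    (hS2 : JetchevDivisibilityReadingS2) (hSig : LeafSigmaStarDivisibilityAtThreeOptimalOffRows)
    (hTU0 : ∀ (W : WeierstrassCurve ℚ) [W.IsElliptic] [W.IsGloballyMinimal], ¬ W.HasCM →
      Literature.NumberTheory.EllipticCurves.Rank1Residual.Addv W 3 →
      Summit.BirchSwinnertonDyer.Rank1Residual.Additive.SubGss W 3 → W.analyticRank = 0 →
      ∃ (K : Type) (_ : Field K) (_ : NumberField K) (W₂ W₂d : WeierstrassCurve ℚ) (_ : W₂.IsElliptic)
        (_ : W₂.IsGloballyMinimal) (_ : W₂d.IsElliptic) (_ : W₂d.IsGloballyMinimal),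
        IsImaginaryQuadratic K ∧ Odd (NumberField.discr K) ∧ SatisfiesHeegnerHypothesis (W.conductorNorm ℤ) K ∧
        (W.quadraticTwist (NumberField.discr K : ℚ)).entireLFunction 1 = 0 ∧
        deriv (W.quadraticTwist (NumberField.discr K : ℚ)).entireLFunction 1 ≠ 0 ∧
        IsIsogenous W W₂ ∧ (∃ C : VariableChange ℚ, C • W₂.quadraticTwist (NumberField.discr K : ℚ) = W₂d) ∧
        ∃ qd : ℚ, shaAn W₂d = (qd : ℂ) ∧ padicValRat 3 qd ≤ 0)
    (hTU1 : ∀ (W : WeierstrassCurve ℚ) [W.IsElliptic] [W.IsGloballyMinimal], ¬ W.HasCM →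
      Literature.NumberTheory.EllipticCurves.Rank1Residual.Addv W 3 →
      Summit.BirchSwinnertonDyer.Rank1Residual.Additive.SubGss W 3 → W.analyticRank = 1 →
      SchneiderFree.Upper.TwistUnitFieldAt W 3) :
    Summit.BirchSwinnertonDyer.WAllExclAddGssAtThree := by
  obtain ⟨⟨hGZ, hKo, -, hGZK, hmod, -, -, -, -, -⟩, -⟩ := id hpub
  have hU0 : LeafRankZeroUpperAtThree :=
    RamifiedPairUpperBound.leafRankZeroUpperAtThree_of_pubManin_of_divisibilityReading_of_sigmaStar_of_twistUnitZero hpub0 hS2 hSig hTU0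
  have hU03 := RamifiedPairUpperBound.nonSurjThreeRows_of_leafRankZeroUpperAtThree hU0
  have hL1 : Gss2LowerAtThreeRankOne :=
    gss2LowerAtThreeRankOne_of_pub_of_certificatesTower_of_structIrr_of_certificates3Nn_of_upper3Nn hpub hC hMN hC3 hU03
  have hU1 : LeafRankOneUpperAtThree :=
    RamifiedPairUpperBound.leafRankOneUpperAtThree_of_pubManin_of_divisibilityReading_of_sigmaStar_of_twistUnit hpubU hS2 hSig hTU1
  have hL0 : Gss2LowerAtThreeRankZero :=
    gss2LowerAtThreeRankZero_of_structIrr_of_certificatesZero_of_leafRankOneUpper hGZ hKo hGZK hmod hMN hC0 hU1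
  exact closes hP hL1 hU1 hL0 hU0

end Summit.BirchSwinnertonDyer.BirchSwinnertonDyer.Theorems.RamifiedPairLowerBound

end
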